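import Mathlib
import HarnessLib
import HarnessLib.Audit
import Summits.NavierStokesRegularity.NavierStokesRegularity.Theorems.L3TimeExponentPincerLocalMorreyZoom
import Summits.NavierStokesRegularity.NavierStokesRegularity.Theorems.L3TimeExponentPincerFullMorreyHardCoreMeet
import Literature.Analysis.FluidPDE.LiouvilleExcludesLocalTypeI
import Summits.NavierStokesRegularity.NavierStokesRegularity.Theses.TypeILiouville
import Summits.NavierStokesRegularity.NavierStokesRegularity.Theorems.L3TimeExponentPincerSubparabolicMorreyJaw
import Summits.NavierStokesRegularity.NavierStokesRegularity.Theorems.L3TimeExponentPincerPaceDichotomy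

/-!
# Local Morrey regularity and the singular points of Morrey-Type-I blow-ups
# (crux `EffSatBlowup`, item `stmt-NavierStokesRegularity-19139`, route `L3TimeExponentPincer`, line `pace`)

Support file (theorems only, no definition, no `sorry`; `--supports stmt-NavierStokesRegularity-19139`,
seat ns-pincer-19139-p1, gen 2; sequel to `Theorems/L3TimeExponentPincerFullMorreyHardCoreMeet.lean`).
That file showed: if no local Type I singular point exists (`¬ LocalTypeISingularityExists`, hence under hard
core 10661 (L)), a frame blow-up in stub 2's class `MorreyTypeINear` (Barker–Prange 2020 (1.7): Morrey-Type-I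
on the top windows `T - r² < t < T`) violates the sub-parabolic Morrey bound SOMEWHERE.  Here the statement is
LOCALISED AT THE SINGULAR POINTS: the zoom lemma of route TypeICertificateLadder
(`Theorems.exists_zoom_typeIBound_lt_top_of_morrey`) reads the Morrey hypothesis only on balls centred in
`B(x₀, R)`, `R ≤ r₀`, so a Morrey bound on the centres `x₁ ∈ B(x₀, r₀)` alone makes the zoom about `(T, x₀)`
locally Type I and `(T, x₀)` backward-regular.  Consequences for line `pace`:

* (file `…LocalMorreyZoom.lean`) `exists_zoom_typeIBound_lt_top_of_localMorrey`,
  `isBackwardBoundedAt_of_localMorrey_of_not_localTypeISingularityExists` — the tree's zoom lemma and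
  backward-boundedness theorem with the Morrey hypothesis restricted to centres in `B(x₀, r₀)`;
* `exists_localMorreyBochner_of_morreyTypeINear_of_localSub` — `MorreyTypeINear` (global, top windows) + a
  sub-parabolic Morrey bound near `x₀` = a local full Morrey bound near `x₀`;
* `isBackwardBoundedAt_of_morreyTypeINear_of_localSub` — hence, if no local Type I singular point exists, every
  point near which a Morrey-Type-I frame solution is ALSO sub-parabolically Morrey-bounded is backward-regular;
* `exists_subparabolic_concentration_near_of_not_isBackwardBoundedAt` — contrapositive: **at a singular point
  `x₀` of a Morrey-Type-I frame solution, for every `M`, every `δ > 0` and every final window there is a late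
  slice with `∫_{B(x₁,r)} |u(t)|² > M r` on a ball of sub-parabolic radius `r ≤ √(T-t)` centred in `B(x₀, δ)`**
  — deep `L²` concentration below the parabolic scale ACCUMULATES AT THE SINGULARITY;
* `not_isBackwardBoundedAt_of_singular`, `exists_singularPoint_subparabolic_concentration_of_morreyTypeI_blowup`
  — a frame blow-up has a singular point (Lemarié-Rieusset 2016, Thm. 15.1 (C),
  `exists_singularPoint_of_classical_of_not_hasSmoothExtensionPast`), so every Morrey-Type-I frame blow-up has a
  point at which the above concentration accumulates; `…_of_typeIliouvilleL` — the same under hard core 10661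
  (`Theses.TypeILiouville.TypeIliouvilleL`) BY NAME.

* `superparabolic_or_subparabolic_concentration_of_blowup` — the SCALE DICHOTOMY of line `pace` modulo the
  hypothesis: every frame blow-up concentrates `L²` super-critically (`∫_B |u(t)|² > M r`, every `M`) either at
  super-parabolic scale (stub 3's class `¬ MorreyTypeINear`) or at sub-parabolic scale at a singular point
  (stub 2's residual).

All results are CONDITIONAL on `¬ LocalTypeISingularityExists` resp. (L); nothing here closes item 19139.
References: D. Albritton, T. Barker, arXiv:1811.00502 (J. Math. Fluid Mech. 21, 2019), Thm. 1.1, Lemma 2.6;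
T. Barker, C. Prange, arXiv:1812.09115 (ARMA 236, 2020), (1.7) and Thm. 2; P. G. Lemarié-Rieusset (2016), Thm. 15.1;
G. Seregin, V. Šverák, arXiv:0804.1803 (2009), Lemma 3.5 / Thm. 2.8.
WHAT THIS IS NOT: not a proof of anything about Navier–Stokes regularity or blow-up; conditional reductions only.
-/

noncomputable section

namespace Summit.NavierStokesRegularity.NavierStokesRegularity.Theorems.L3TimeExponentPincerLocalMorreyRegularity

open Set Filter Topology MeasureTheory
open Function TopologicalSpace Metric
open Literature.Analysis.FluidPDE
open scoped ENNReal NNReal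
open Summit.NavierStokesRegularity.NavierStokesRegularity.Theorems.L3TimeExponentPincerPaceDichotomy
  (MorreyTypeINear)
open Summit.NavierStokesRegularity.NavierStokesRegularity.Theorems.L3TimeExponentPincerSubparabolicMorreyJaw
  (SubparabolicMorreyNear)
open Summit.NavierStokesRegularity.NavierStokesRegularity.Theorems.L3TimeExponentPincerLocalMorreyZoom
  (isBackwardBoundedAt_of_localMorrey_of_not_localTypeISingularityExists)
open Summit.NavierStokesRegularity.NavierStokesRegularity.Theorems.L3TimeExponentPincerFullMorreyHardCoreMeet
  (not_localTypeISingularityExists_of_typeIliouvilleL)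

variable {ν T : ℝ} {u : ℝ → EuclideanSpace ℝ (Fin 3) → EuclideanSpace ℝ (Fin 3)}
  {p : ℝ → EuclideanSpace ℝ (Fin 3) → ℝ}

/-! ## §2  Morrey-Type-I (top windows) + sub-parabolic Morrey near `x₀` = local full Morrey near `x₀` -/

/-- **Top ∧ bottom, locally.**  A Leray–Hopf solution on `[0, T)` with the GLOBAL top-window bound
`MorreyTypeINear u T` (Barker–Prange (1.7)) and a sub-parabolic Morrey bound on the centres `x₁ ∈ B(x₀, δ)`
(`∫_{B(x₁,r)}|u(t)|² ≤ M r` for `0 < r`, `r² ≤ T - t`, `t ∈ (T₁, T)`) satisfies the local Morrey hypothesis of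
`exists_zoom_typeIBound_lt_top_of_localMorrey` at `x₀` (Bochner spelling, all radii `≤ r₀`, a final interval
inside `[0, T)`). -/
theorem exists_localMorreyBochner_of_morreyTypeINear_of_localSub (hT : 0 < T)
    (hLH : IsLerayHopfOn T ν 0 (u 0) u) (hM : MorreyTypeINear u T) (x₀ : EuclideanSpace ℝ (Fin 3))
    {M δ T₁ : ℝ} (hδ : 0 < δ) (hT₁ : T₁ < T)
    (hS : ∀ t ∈ Ioo T₁ T, ∀ x₁ ∈ ball x₀ δ, ∀ r : ℝ, 0 < r → r ^ 2 ≤ T - t →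
      ∫⁻ x in ball x₁ r, ‖u t x‖ₑ ^ 2 ≤ ENNReal.ofReal (M * r)) :
    ∃ r₀ M₀ T₂ : ℝ, 0 < r₀ ∧ T₂ < T ∧
      ∀ t ∈ Ioo T₂ T, ∀ x₁ ∈ ball x₀ r₀, ∀ (r : ℝ), 0 < r → r ≤ r₀ →
        ∫ x in ball x₁ r, ‖u t x‖ ^ 2 ≤ M₀ * r := by
  obtain ⟨M', hM'pos, r₁, hr₁, hTop⟩ := hM
  refine ⟨min δ (r₁ / 2), max (max M M') 0, max T₁ 0, lt_min hδ (by positivity), max_lt hT₁ hT,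
    fun t ht x₁ hx₁ r hr hrr => ?_⟩
  have ht₁ : T₁ < t := lt_of_le_of_lt (le_max_left _ _) ht.1
  have ht0 : 0 < t := lt_of_le_of_lt (le_max_right _ _) ht.1
  have htI : t ∈ Icc 0 T := ⟨ht0.le, ht.2.le⟩
  have hx₁δ : x₁ ∈ ball x₀ δ := ball_subset_ball (min_le_left _ _) hx₁
  have hrr₁ : r < r₁ := by linarith [le_trans hrr (min_le_right δ (r₁ / 2))]
  have hint : IntegrableOn (fun x => ‖u t x‖ ^ 2) (ball x₁ r) :=
    ((hLH.memLp t htI).integrable_norm_pow two_ne_zero).integrableOn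
  have e : ∫⁻ x in ball x₁ r, ‖u t x‖ₑ ^ 2 = ENNReal.ofReal (∫ x in ball x₁ r, ‖u t x‖ ^ 2) := by
    rw [ofReal_integral_eq_lintegral_ofReal hint (Eventually.of_forall fun x => by positivity)]
    refine lintegral_congr fun x => ?_
    rw [← ofReal_norm, ENNReal.ofReal_pow (norm_nonneg _)]
  have hMM : 0 ≤ max (max M M') 0 := le_max_right _ _
  -- the lower-Lebesgue bound with the constant `max (max M M') 0`
  have hlin : ∫⁻ x in ball x₁ r, ‖u t x‖ₑ ^ 2 ≤ ENNReal.ofReal (max (max M M') 0 * r) := by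
    rcases le_or_gt (r ^ 2) (T - t) with hcase | hcase
    · exact (hS t ⟨ht₁, ht.2⟩ x₁ hx₁δ r hr hcase).trans (ENNReal.ofReal_le_ofReal
        (mul_le_mul_of_nonneg_right ((le_max_left _ _).trans (le_max_left _ _)) hr.le))
    · have h1 : T - r ^ 2 < t := by linarith
      exact (hTop x₁ r hr hrr₁ t h1 ht.2).trans (ENNReal.ofReal_le_ofReal
        (mul_le_mul_of_nonneg_right ((le_max_right _ _).trans (le_max_left _ _)) hr.le))
  rw [e] at hlin
  exact (ENNReal.ofReal_le_ofReal_iff (by positivity)).1 hlin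

/-- **Backward regularity at a point with top-window Morrey bound globally and sub-parabolic Morrey bound
locally**, if no local Type I singular point exists: for a classical Leray–Hopf solution on `[0, T)` in stub 2's
class `MorreyTypeINear`, every `x₀` carrying a sub-parabolic Morrey bound on the centres of a neighbourhood
`B(x₀, δ)` is backward-bounded at `(T, x₀)`.  CONDITIONAL on `hno`. -/
theorem isBackwardBoundedAt_of_morreyTypeINear_of_localSub (hno : ¬ LocalTypeISingularityExists)
    (hν : 0 < ν) (hT : 0 < T) (hsol : IsClassicalNSSolutionOn (Ico 0 T) ν 0 u p)
    (hLH : IsLerayHopfOn T ν 0 (u 0) u) (hM : MorreyTypeINear u T) (x₀ : EuclideanSpace ℝ (Fin 3))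
    {M δ T₁ : ℝ} (hδ : 0 < δ) (hT₁ : T₁ < T)
    (hS : ∀ t ∈ Ioo T₁ T, ∀ x₁ ∈ ball x₀ δ, ∀ r : ℝ, 0 < r → r ^ 2 ≤ T - t →
      ∫⁻ x in ball x₁ r, ‖u t x‖ₑ ^ 2 ≤ ENNReal.ofReal (M * r)) :
    IsBackwardBoundedAt u T x₀ := by
  obtain ⟨r₀, M₀, T₂, hr₀, hT₂, hMor⟩ :=
    exists_localMorreyBochner_of_morreyTypeINear_of_localSub hT hLH hM x₀ hδ hT₁ hS
  exact isBackwardBoundedAt_of_localMorrey_of_not_localTypeISingularityExists hno hν hT hsol hLH x₀ hr₀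
    hT₂ hMor

/-! ## §3  Sub-parabolic `L²` concentration accumulates at the singular points of Morrey-Type-I blow-ups -/

/-- **At a singular point of a Morrey-Type-I frame solution, sub-parabolic concentration accumulates**
(no local Type I singular point assumed): if `(T, x₀)` is NOT backward-bounded and `u` is in stub 2's class
`MorreyTypeINear`, then for every `M`, every `δ > 0` and every `T₁ < T` there are a late time `t ∈ (T₁, T)`,
a centre `x₁ ∈ B(x₀, δ)` and a sub-parabolic radius `0 < r`, `r² ≤ T - t`, with `∫_{B(x₁,r)}|u(t)|² > M r`.
CONDITIONAL on `hno`. -/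
theorem exists_subparabolic_concentration_near_of_not_isBackwardBoundedAt
    (hno : ¬ LocalTypeISingularityExists) (hν : 0 < ν) (hT : 0 < T)
    (hsol : IsClassicalNSSolutionOn (Ico 0 T) ν 0 u p) (hLH : IsLerayHopfOn T ν 0 (u 0) u)
    (hM : MorreyTypeINear u T) {x₀ : EuclideanSpace ℝ (Fin 3)} (hsing : ¬ IsBackwardBoundedAt u T x₀)
    (M : ℝ) {δ : ℝ} (hδ : 0 < δ) {T₁ : ℝ} (hT₁ : T₁ < T) :
    ∃ t ∈ Ioo T₁ T, ∃ x₁ ∈ ball x₀ δ, ∃ r : ℝ, 0 < r ∧ r ^ 2 ≤ T - t ∧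
      ENNReal.ofReal (M * r) < ∫⁻ x in ball x₁ r, ‖u t x‖ₑ ^ 2 := by
  by_contra hcon
  push Not at hcon
  exact hsing (isBackwardBoundedAt_of_morreyTypeINear_of_localSub hno hν hT hsol hLH hM x₀ hδ hT₁
    fun t ht x₁ hx₁ r hr hrs => hcon t ht x₁ hx₁ r hr hrs)

/-- A point `x₀` at which `u` is essentially unbounded on every small backward cylinder `Q_r(T, x₀)` (a
singular point in the sense of `exists_singularPoint_of_classical_of_not_hasSmoothExtensionPast`) is not
backward-bounded. -/
theorem not_isBackwardBoundedAt_of_singular (hT : 0 < T) {x₀ : EuclideanSpace ℝ (Fin 3)}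
    (hx₀ : ∀ r : ℝ, 0 < r → r ^ 2 < T →
      eLpNorm (uncurry u) ⊤ (volume.restrict (parabolicCylinder r ((T : ℝ), x₀))) = ⊤) :
    ¬ IsBackwardBoundedAt u T x₀ := by
  rintro ⟨r, hr, C, hC⟩
  -- a radius `r' ≤ r` with `r'² < T`
  obtain ⟨r', hr', hr'r, hr'T⟩ : ∃ r' : ℝ, 0 < r' ∧ r' ≤ r ∧ r' ^ 2 < T := by
    refine ⟨min r (Real.sqrt T / 2), lt_min hr (by positivity), min_le_left _ _, ?_⟩
    have h1 : min r (Real.sqrt T / 2) ≤ Real.sqrt T / 2 := min_le_right _ _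
    have h2 : 0 < min r (Real.sqrt T / 2) := lt_min hr (by positivity)
    have h3 : (Real.sqrt T / 2) ^ 2 = T / 4 := by rw [div_pow, Real.sq_sqrt hT.le]; norm_num
    nlinarith [pow_le_pow_left₀ h2.le h1 2]
  have hfin : eLpNorm (uncurry u) ⊤ (volume.restrict (parabolicCylinder r' ((T : ℝ), x₀))) < ⊤ := by
    rw [eLpNorm_exponent_top]
    refine eLpNormEssSup_lt_top_of_ae_bound (C := C) ?_
    refine (ae_restrict_mem (measurableSet_Ioo.prod measurableSet_ball)).mono ?_
    rintro ⟨t, x⟩ hz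
    have ht : t ∈ Ioo (T - r ^ 2) T :=
      ⟨lt_of_le_of_lt (by nlinarith [pow_le_pow_left₀ hr'.le hr'r 2]) hz.1.1, hz.1.2⟩
    exact hC t ht x (ball_subset_ball hr'r hz.2)
  exact hfin.ne (hx₀ r' hr' hr'T)

/-- **A frame blow-up has a point that is not backward-bounded** (Lemarié-Rieusset 2016, Thm. 15.1 (C), in
the tree as `exists_singularPoint_of_classical_of_not_hasSmoothExtensionPast`: a classical Leray–Hopf solution
from a rapidly decaying datum with no smooth extension past `T` has a singular point at time `T`). -/
theorem exists_not_isBackwardBoundedAt_of_blowup (hν : 0 < ν) (hT : 0 < T)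
    (hsol : IsClassicalNSSolutionOn (Ico 0 T) ν 0 u p) (hLH : IsLerayHopfOn T ν 0 (u 0) u)
    (hdec : HasRapidSpatialDecay (u 0)) (hbu : ¬ HasSmoothExtensionPast ν 0 u T) :
    ∃ x₀ : EuclideanSpace ℝ (Fin 3), ¬ IsBackwardBoundedAt u T x₀ := by
  obtain ⟨x₀, hx₀⟩ := exists_singularPoint_of_classical_of_not_hasSmoothExtensionPast hν hT hsol hLH hdec hbu
  exact ⟨x₀, not_isBackwardBoundedAt_of_singular hT hx₀⟩

/-- **Every Morrey-Type-I frame blow-up has a point at which sub-parabolic `L²` concentration accumulates**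
(no local Type I singular point assumed): for a frame blow-up in stub 2's class `MorreyTypeINear` there is
`x₀` (a singular point) such that for every `M`, `δ > 0`, `T₁ < T` some late slice carries
`∫_{B(x₁,r)}|u(t)|² > M r` on a ball of sub-parabolic radius `r ≤ √(T-t)` centred in `B(x₀, δ)`.
The residual of stub 2 modulo `¬ LocalTypeISingularityExists` / (L), LOCALISED.  CONDITIONAL on `hno`. -/
theorem exists_singularPoint_subparabolic_concentration_of_morreyTypeI_blowup
    (hno : ¬ LocalTypeISingularityExists) (hν : 0 < ν) (hT : 0 < T)
    (hsol : IsClassicalNSSolutionOn (Ico 0 T) ν 0 u p) (hLH : IsLerayHopfOn T ν 0 (u 0) u)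
    (hdec : HasRapidSpatialDecay (u 0)) (hbu : ¬ HasSmoothExtensionPast ν 0 u T)
    (hM : MorreyTypeINear u T) :
    ∃ x₀ : EuclideanSpace ℝ (Fin 3), ¬ IsBackwardBoundedAt u T x₀ ∧
      ∀ M : ℝ, ∀ δ : ℝ, 0 < δ → ∀ T₁ : ℝ, T₁ < T →
        ∃ t ∈ Ioo T₁ T, ∃ x₁ ∈ ball x₀ δ, ∃ r : ℝ, 0 < r ∧ r ^ 2 ≤ T - t ∧
          ENNReal.ofReal (M * r) < ∫⁻ x in ball x₁ r, ‖u t x‖ₑ ^ 2 := by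
  obtain ⟨x₀, hx₀⟩ := exists_not_isBackwardBoundedAt_of_blowup hν hT hsol hLH hdec hbu
  exact ⟨x₀, hx₀, fun M δ hδ T₁ hT₁ =>
    exists_subparabolic_concentration_near_of_not_isBackwardBoundedAt hno hν hT hsol hLH hM hx₀ M hδ hT₁⟩

/-! ## §3a  The scale dichotomy of line `pace` modulo `¬ LocalTypeISingularityExists` -/

/-- The negated top-window bound, unfolded: `¬ MorreyTypeINear u T` says that for every level `M > 0` and
every `r₁ > 0` some ball of radius `r < r₁` carries `∫_{B(x₀,r)}|u(t)|² > M r` at a time `t` of its TOP window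
`T - r² < t < T`, i.e. at SUPER-parabolic scale `r > √(T-t)` — stub 3's class. -/
theorem exists_superparabolic_concentration_of_not_morreyTypeINear (h : ¬ MorreyTypeINear u T)
    {M : ℝ} (hM : 0 < M) {r₁ : ℝ} (hr₁ : 0 < r₁) :
    ∃ x₀ : EuclideanSpace ℝ (Fin 3), ∃ r : ℝ, 0 < r ∧ r < r₁ ∧ ∃ t : ℝ, T - r ^ 2 < t ∧ t < T ∧
      ENNReal.ofReal (M * r) < ∫⁻ x in ball x₀ r, ‖u t x‖ₑ ^ 2 := by
  by_contra hcon
  push Not at hcon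
  exact h ⟨M, hM, r₁, hr₁, fun x₀ r hr hrr t ht1 ht2 => hcon x₀ r hr hrr t ht1 ht2⟩

/-- **The scale dichotomy of line `pace`, modulo `¬ LocalTypeISingularityExists`.**  A frame blow-up EITHER
carries super-critical `L²` concentration `∫_{B}|u(t)|² > M r` at SUPER-parabolic scale (balls in their top window,
every level `M`, arbitrarily small radii: stub 3's class `¬ MorreyTypeINear`) OR is Morrey-Type-I on the top
windows and then carries it at SUB-parabolic scale accumulating at a singular point (stub 2's residual).  In both
cases the scaled local kinetic energy is unbounded near `T` (no Full-Morrey blow-up).  CONDITIONAL on `hno`. -/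
theorem superparabolic_or_subparabolic_concentration_of_blowup (hno : ¬ LocalTypeISingularityExists)
    (hν : 0 < ν) (hT : 0 < T) (hsol : IsClassicalNSSolutionOn (Ico 0 T) ν 0 u p)
    (hLH : IsLerayHopfOn T ν 0 (u 0) u) (hdec : HasRapidSpatialDecay (u 0))
    (hbu : ¬ HasSmoothExtensionPast ν 0 u T) :
    (∀ M : ℝ, 0 < M → ∀ r₁ : ℝ, 0 < r₁ →
        ∃ x₀ : EuclideanSpace ℝ (Fin 3), ∃ r : ℝ, 0 < r ∧ r < r₁ ∧ ∃ t : ℝ, T - r ^ 2 < t ∧ t < T ∧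
          ENNReal.ofReal (M * r) < ∫⁻ x in ball x₀ r, ‖u t x‖ₑ ^ 2) ∨
    (MorreyTypeINear u T ∧ ∃ x₀ : EuclideanSpace ℝ (Fin 3), ¬ IsBackwardBoundedAt u T x₀ ∧
      ∀ M : ℝ, ∀ δ : ℝ, 0 < δ → ∀ T₁ : ℝ, T₁ < T →
        ∃ t ∈ Ioo T₁ T, ∃ x₁ ∈ ball x₀ δ, ∃ r : ℝ, 0 < r ∧ r ^ 2 ≤ T - t ∧
          ENNReal.ofReal (M * r) < ∫⁻ x in ball x₁ r, ‖u t x‖ₑ ^ 2) := by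
  by_cases hM : MorreyTypeINear u T
  · exact Or.inr ⟨hM,
      exists_singularPoint_subparabolic_concentration_of_morreyTypeI_blowup hno hν hT hsol hLH hdec hbu hM⟩
  · exact Or.inl fun M hMpos r₁ hr₁ => exists_superparabolic_concentration_of_not_morreyTypeINear hM hMpos hr₁

/-! ## §3b  How deep: the concentration radius is at most `(M₀/M)·√(T-t)` -/

/-- **The top-window bound caps the concentration radius.**  If `u` is Morrey-Type-I on the top windows with
constant `M₀` below radius `r₁` (`MorreyTypeINear`'s data) and a late slice (`T - t < r₁²`) carries
`∫_{B(x₁,r)}|u(t)|² > M r` on a ball with `0 < r`, `r² ≤ T - t`, then `M r ≤ M₀ √(T-t)`: every ball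
`B(x₁, ρ)`, `√(T-t) < ρ < r₁`, contains `B(x₁, r)` and has energy `≤ M₀ ρ`.  So level-`M` concentration
happens at radius `≤ (M₀/M) √(T-t)` — deeper and deeper below the parabolic scale as `M → ∞`. -/
theorem mul_radius_le_of_concentration_of_topMorrey {M₀ r₁ : ℝ} (hM₀ : 0 < M₀) (hr₁ : 0 < r₁)
    (hTop : ∀ x₀ : EuclideanSpace ℝ (Fin 3), ∀ ρ : ℝ, 0 < ρ → ρ < r₁ →
      ∀ t : ℝ, T - ρ ^ 2 < t → t < T → ∫⁻ x in ball x₀ ρ, ‖u t x‖ₑ ^ 2 ≤ ENNReal.ofReal (M₀ * ρ))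
    {t : ℝ} (htT : t < T) (hts : T - t < r₁ ^ 2) {x₁ : EuclideanSpace ℝ (Fin 3)} {M r : ℝ}
    (hr : 0 < r) (hrs : r ^ 2 ≤ T - t)
    (hconc : ENNReal.ofReal (M * r) < ∫⁻ x in ball x₁ r, ‖u t x‖ₑ ^ 2) :
    M * r ≤ M₀ * Real.sqrt (T - t) := by
  have hs : 0 < T - t := sub_pos.2 htT
  have hsq : Real.sqrt (T - t) ^ 2 = T - t := Real.sq_sqrt hs.le
  have hsqpos : 0 < Real.sqrt (T - t) := Real.sqrt_pos.2 hs
  -- `√(T-t) < r₁`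
  have hsr₁ : Real.sqrt (T - t) < r₁ := by
    rw [← Real.sqrt_sq hr₁.le]
    exact Real.sqrt_lt_sqrt hs.le hts
  -- every `ρ ∈ (√(T-t), r₁)` bounds `M r < M₀ ρ`
  have hρ : ∀ ρ : ℝ, Real.sqrt (T - t) < ρ → ρ < r₁ → M * r < M₀ * ρ := by
    intro ρ hρ1 hρ2
    have hρpos : 0 < ρ := hsqpos.trans hρ1
    have hwin : T - ρ ^ 2 < t := by nlinarith
    have hrρ : r ≤ ρ := by nlinarith [Real.sqrt_le_sqrt hrs, Real.sqrt_sq hr.le]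
    have h1 : ENNReal.ofReal (M * r) < ENNReal.ofReal (M₀ * ρ) :=
      lt_of_lt_of_le hconc ((lintegral_mono_set (ball_subset_ball hrρ)).trans
        (hTop x₁ ρ hρpos hρ2 t hwin htT))
    exact (ENNReal.ofReal_lt_ofReal_iff (by positivity)).1 h1
  -- conclude by density of `(√(T-t), r₁)` at its left end
  by_contra hcon
  rw [not_le] at hcon
  have hlt : Real.sqrt (T - t) < min r₁ (M * r / M₀) :=
    lt_min hsr₁ (by rw [lt_div_iff₀ hM₀]; linarith)
  obtain ⟨ρ, hρ1, hρ2⟩ := exists_between hlt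
  have h2 := hρ ρ hρ1 (lt_of_lt_of_le hρ2 (min_le_left _ _))
  have h3 : ρ < M * r / M₀ := lt_of_lt_of_le hρ2 (min_le_right _ _)
  rw [lt_div_iff₀ hM₀] at h3
  linarith

/-- **Localised residual with the depth bound** (no local Type I singular point assumed): at a singular point
`x₀` of a Morrey-Type-I frame solution with top-window data `(M₀, r₁)`, for every level `M`, every `δ > 0` and
every final window there is a late slice carrying `∫_{B(x₁,r)}|u(t)|² > M r` on a ball centred in `B(x₀, δ)` of
radius `r` with `r² ≤ T - t` AND `M r ≤ M₀ √(T-t)`.  CONDITIONAL on `hno`. -/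
theorem exists_deep_concentration_near_of_not_isBackwardBoundedAt
    (hno : ¬ LocalTypeISingularityExists) (hν : 0 < ν) (hT : 0 < T)
    (hsol : IsClassicalNSSolutionOn (Ico 0 T) ν 0 u p) (hLH : IsLerayHopfOn T ν 0 (u 0) u)
    {M₀ r₁ : ℝ} (hM₀ : 0 < M₀) (hr₁ : 0 < r₁)
    (hTop : ∀ x₀ : EuclideanSpace ℝ (Fin 3), ∀ ρ : ℝ, 0 < ρ → ρ < r₁ →
      ∀ t : ℝ, T - ρ ^ 2 < t → t < T → ∫⁻ x in ball x₀ ρ, ‖u t x‖ₑ ^ 2 ≤ ENNReal.ofReal (M₀ * ρ))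
    {x₀ : EuclideanSpace ℝ (Fin 3)} (hsing : ¬ IsBackwardBoundedAt u T x₀)
    (M : ℝ) {δ : ℝ} (hδ : 0 < δ) {T₁ : ℝ} (hT₁ : T₁ < T) :
    ∃ t ∈ Ioo T₁ T, ∃ x₁ ∈ ball x₀ δ, ∃ r : ℝ, 0 < r ∧ r ^ 2 ≤ T - t ∧ M * r ≤ M₀ * Real.sqrt (T - t) ∧
      ENNReal.ofReal (M * r) < ∫⁻ x in ball x₁ r, ‖u t x‖ₑ ^ 2 := by
  have hMTI : MorreyTypeINear u T := ⟨M₀, hM₀, r₁, hr₁, hTop⟩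
  -- shrink the window so that `T - t < r₁²`
  have hT₁' : max T₁ (T - r₁ ^ 2) < T := max_lt hT₁ (by nlinarith)
  obtain ⟨t, ht, x₁, hx₁, r, hr, hrs, hconc⟩ :=
    exists_subparabolic_concentration_near_of_not_isBackwardBoundedAt hno hν hT hsol hLH hMTI hsing M hδ hT₁'
  have ht₁ : T₁ < t := lt_of_le_of_lt (le_max_left _ _) ht.1
  have hts : T - t < r₁ ^ 2 := by linarith [lt_of_le_of_lt (le_max_right _ _) ht.1]
  exact ⟨t, ⟨ht₁, ht.2⟩, x₁, hx₁, r, hr, hrs,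
    mul_radius_le_of_concentration_of_topMorrey hM₀ hr₁ hTop ht.2 hts hr hrs hconc, hconc⟩

/-! ## §4  The same under hard core `stmt-NavierStokesRegularity-10661` (L) BY NAME -/

/-- **(L) ⇒ at a singular point of a Morrey-Type-I frame blow-up sub-parabolic `L²` concentration accumulates**
(hard core 10661 BY NAME). -/
theorem exists_singularPoint_subparabolic_concentration_of_morreyTypeI_blowup_of_typeIliouvilleL
    (hL : Summit.NavierStokesRegularity.NavierStokesRegularity.Theses.TypeILiouville.TypeIliouvilleL)
    (hν : 0 < ν) (hT : 0 < T)
    (hsol : IsClassicalNSSolutionOn (Ico 0 T) ν 0 u p) (hLH : IsLerayHopfOn T ν 0 (u 0) u)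
    (hdec : HasRapidSpatialDecay (u 0)) (hbu : ¬ HasSmoothExtensionPast ν 0 u T)
    (hM : MorreyTypeINear u T) :
    ∃ x₀ : EuclideanSpace ℝ (Fin 3), ¬ IsBackwardBoundedAt u T x₀ ∧
      ∀ M : ℝ, ∀ δ : ℝ, 0 < δ → ∀ T₁ : ℝ, T₁ < T →
        ∃ t ∈ Ioo T₁ T, ∃ x₁ ∈ ball x₀ δ, ∃ r : ℝ, 0 < r ∧ r ^ 2 ≤ T - t ∧
          ENNReal.ofReal (M * r) < ∫⁻ x in ball x₁ r, ‖u t x‖ₑ ^ 2 :=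
  exists_singularPoint_subparabolic_concentration_of_morreyTypeI_blowup
    (not_localTypeISingularityExists_of_typeIliouvilleL hL) hν hT hsol hLH hdec hbu hM

/-- **(L) ⇒ every singular point of a Morrey-Type-I frame solution is a sub-parabolic concentration point**:
under hard core 10661, a point `x₀` of a classical Leray–Hopf solution in stub 2's class at which some
neighbourhood carries a sub-parabolic Morrey bound is backward-regular. -/
theorem isBackwardBoundedAt_of_morreyTypeINear_of_localSub_of_typeIliouvilleL
    (hL : Summit.NavierStokesRegularity.NavierStokesRegularity.Theses.TypeILiouville.TypeIliouvilleL)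
    (hν : 0 < ν) (hT : 0 < T) (hsol : IsClassicalNSSolutionOn (Ico 0 T) ν 0 u p)
    (hLH : IsLerayHopfOn T ν 0 (u 0) u) (hM : MorreyTypeINear u T) (x₀ : EuclideanSpace ℝ (Fin 3))
    {M δ T₁ : ℝ} (hδ : 0 < δ) (hT₁ : T₁ < T)
    (hS : ∀ t ∈ Ioo T₁ T, ∀ x₁ ∈ ball x₀ δ, ∀ r : ℝ, 0 < r → r ^ 2 ≤ T - t →
      ∫⁻ x in ball x₁ r, ‖u t x‖ₑ ^ 2 ≤ ENNReal.ofReal (M * r)) :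
    IsBackwardBoundedAt u T x₀ :=
  isBackwardBoundedAt_of_morreyTypeINear_of_localSub (not_localTypeISingularityExists_of_typeIliouvilleL hL)
    hν hT hsol hLH hM x₀ hδ hT₁ hS

end Summit.NavierStokesRegularity.NavierStokesRegularity.Theorems.L3TimeExponentPincerLocalMorreyRegularity

end
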